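import Literature.AlgebraicGeometry.ComplexMultiplication.CyclotomicFermatCMTypesOddTwoPrimeLevelIsogenies
import Literature.AlgebraicGeometry.ComplexMultiplication.CyclotomicFermatCMTypesTheoremTwoFamilies
import HarnessLib

/-!
# Koblitz–Rohrlich, THEOREM 2 (relatively prime case) at the exceptional levels `N = 21, 39` — hence at EVERY odd two-prime level:
# `Φ_{(1,a,−1−a)}` is primitive (its abelian varieties simple) iff NOT (`1 + a + a² = 0`, `a ≠ 1`); the stabilisers `W` at `21`, `39`

Layer `Literature/AlgebraicGeometry/ComplexMultiplication`, namespace `…ComplexMultiplication.CyclotomicFermatCMType`; sequel of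
`CyclotomicFermatCMTypesOddTwoPrimeLevelIsogenies` (Theorem 1 at `21`, `39`; Remark 2's "`(1, ρ, ρ²)`" enumeration) and
`CyclotomicFermatCMTypesTheoremTwoFamilies` (the first family `{1, w, w²}` is never simple).  THEOREMS ONLY (no definition, no named
fact, no `sorry`); two kernel computations (`decide`) describe the stabilisers at `21` and `39`, the rest is K–R's §1 argument.

THE SOURCE.  N. Koblitz, D. Rohrlich, *Simple factors in the Jacobian of a Fermat curve*, Canad. J. Math. **30** (1978) 1183–1205.
§1 (p. 1184): "Let `W_{r,s} = {w ∈ (ℤ/Mℤ)* : wH_{r,s} = H_{r,s}}`. … `L_{r,s}` is simple if and only if `W_{r,s} = {1}`.  Suppose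
`W_{r,s} ≠ {1}`.  Then `L_{r,s}` is isogenous to a product of `|W_{r,s}|` isomorphic simple factors"; p. 1185: "if `w` is in `W_{r,s,t}`,
then `H_{r,s,t} = wH_{r,s,t} = H_{⟨w⁻¹r⟩,⟨w⁻¹s⟩,⟨w⁻¹t⟩}` so that `{r, s, t} = {⟨w⁻¹r⟩, ⟨w⁻¹s⟩, ⟨w⁻¹t⟩}`. … one deduces that for `w ≠ 1`,
either `1 + w + w² = 0` in `ℤ/Mℤ` or `w² = 1` … THEOREM 2. Suppose `N` is prime to `6`. The only lattices `L_{r,s,t}` which are not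
simple are those for which `{r, s, t}` is equivalent to a triple of the form `{N/M, ⟨wN/M⟩, ⟨w²N/M⟩}` … `1 + w + w² = 0`, or …
`{N/M, ⟨wN/M⟩, ⟨−(1+w)N/M⟩}` … `w² = 1`, `w ≠ ±1`"; §2 REMARK 2 (p. 1193): "When `N = 21, 39`, the non-obvious isogenies in the
relatively prime case all turn out to occur when `J_{r,s,t}` is isogenous to a product of elliptic curves.  In each case we can take
`(r, s, t)` to be `(1, ρ, ρ²)`".

WHAT IS PROVED (relatively prime case, `M = N`: unit triples normalised to `(1, a, −1−a)` with `a`, `1 + a` units).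

* §1 (any level `N`): a unit `t` in the stabiliser gives the coincidence `H_{t,ta,t(−1−a)} = H_{1,a,−1−a}`
  (`fermatCMType_mul_eq_of_forall_mem_unitResidues`; "if `w` is in `W_{r,s,t}`, then `H_{r,s,t} = wH_{r,s,t} = H_{⟨w⁻¹r⟩,…}`"); **K–R's
  deduction of Theorem 2 with Remark 2 in place of the strong (∗)**: if at level `N` every NON-obvious coincidence among unit triples
  forces `a ∈ {ρ₁, ρ₂}` with `1 + ρᵢ + ρᵢ² = 0`, `ρᵢ ≠ 1`, then `W_{1,a,−1−a} = {1}` iff NOT (`1 + a + a² = 0` and `a ≠ 1`)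
  (`hasTrivialStabilizer_fermat_one_iff_of_remarkTwo`; the obvious coincidences are K–R's case analysis, tree
  `eq_one_or_of_multiset_eq_of_isUnit`), hence primitivity / simplicity iff the same (`isPrimitive_fermat_one_iff_of_remarkTwo`,
  `isSimple_of_fermat_one_iff_of_remarkTwo`, Shimura §8.2 Prop. 26 through the tree).
* §2 `N = 21`: **the stabilisers** — for units `a`, `1 + a`, `w`: `wH_{1,a,−1−a} = H_{1,a,−1−a}` iff `w = 1`, or `1 + a + a² = 0` (i.e.
  `a ∈ {4, 16}`, `one_add_add_sq_eq_zero_iff_twentyOne`) and `w ∈ H_{1,4,16}` (`|W| = 6`; kernel computation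
  `fermatCMType_mul_eq_iff_twentyOne`, `forall_mem_fermatCMType_one_iff_mul_mem_iff_twentyOne`); **THEOREM 2 HOLDS at `21`**:
  `W = {1}` ⟺ primitive ⟺ simple ⟺ NOT (`1 + a + a² = 0 ∧ a ≠ 1`) (`hasTrivialStabilizer_fermat_one_iff_twentyOne`,
  `isPrimitive_fermat_one_iff_twentyOne`, `isSimple_of_fermat_one_iff_twentyOne`), with non-vacuity: a SIMPLE `6`-dimensional abelian
  variety of type `Φ_{(1,a,−1−a)}` of `ℚ(ζ₂₁)` exists whenever `a ∉ {4, 16}` (`exists_isSimple_of_fermat_one_twentyOne`).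
* §3 `N = 39`: the same with `ρ = 16`, `ρ² = 22`, `|W| = 12`, dimension `12`.
* §4 **THEOREM 2 AT EVERY ODD TWO-PRIME LEVEL `N = pᵃqᵇ`, NO exception**: `isPrimitive_fermat_one_iff_oddTwoPrimeLevel`,
  `isSimple_of_fermat_one_iff_oddTwoPrimeLevel`, `exists_isSimple_of_fermat_one_oddTwoPrimeLevel` — the sibling's `…_oddTwoPrimes`
  versions minus the hypotheses `N ≠ 21`, `N ≠ 39`.

## Honest column / NOT here

* K–R state Theorem 2 for `N` prime to `6`; at `21`, `39` the statements are OURS (enumeration + K–R's §1 argument).  What differs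
  there is `|W|`: `6` and `12` instead of `3` for the first family (sibling `…OddTwoPrimeLevelExceptional`), i.e. the NUMBER of simple
  factors, which is not typed (needs the induced-type dictionary, see the siblings' honest columns); the simple/non-simple DICHOTOMY of
  Theorem 2 is unchanged and proved here.
* Relatively prime case only (`M = N`, unit triples); the boundary families and the "only" direction of Theorem 2 in the boundary
  cases (K–R §3) are NOT typed here (`…TheoremTwoFamilies` has the converse for both families).
* Kernel `decide` only; `maxRecDepth 100000` for the level-`39` computation.  Private: `isUnit_iff_val_coprime₁₀`.

## References

* [KoblitzRohrlich1978] N. Koblitz, D. Rohrlich, Canad. J. Math. 30 (1978) 1183–1205: §1 (pp. 1184–1185), Theorem 2 (pp. 1185–1186),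
  §2 Remark 2 (p. 1193).
* [Shimura1998] G. Shimura, *Abelian Varieties with Complex Multiplication and Modular Functions*, §6.2 Thm. 3, §8.2 Prop. 26
  (through `CyclotomicCMTypeResidueSets`, `SimpleIffPrimitiveCMType`, `CMAbelianVarietyRealisedHolds`).

## Provenance

Cell `pub-hodgecm2` (COR-CM), literature seat `lit-deligne-3` gen 35 (claim KR78-THM2-EXCEPTIONAL; count-neutral, own lane).
-/

noncomputable section

open NumberField

namespace Literature.AlgebraicGeometry.ComplexMultiplication

open Literature.NumberTheory.ComplexMultiplication
open Literature.NumberTheory.LFunctions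
open Literature.AlgebraicGeometry.HodgeTheory
open Literature.AlgebraicGeometry.Pohlmann1968 Literature.AlgebraicGeometry.Pohlmann1968.Cyclotomic
open CyclotomicCMTypeResidueSets (IsCMResidueSet HasTrivialStabilizer unitResidues)

namespace CyclotomicFermatCMType

/-! ## §1 Any level: stabilisers give coincidences; Theorem 2 from a Remark-2 enumeration -/

section AnyLevel

open CategoryTheory
open Literature.AlgebraicGeometry.Motives (AbelianVariety)

variable {N : ℕ} [NeZero N]

/-- Units of `ℤ/N` are the residues with value prime to `N` (private copy of the siblings'). [folklore] -/
private theorem isUnit_iff_val_coprime₁₀ (x : ZMod N) : IsUnit x ↔ x.val.Coprime N := by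
  conv_lhs => rw [← ZMod.natCast_zmod_val x]
  exact ZMod.isUnit_iff_coprime x.val N

/-- **`wH = H` as a Finset equation**: for a unit `w`, `(∀ x, x ∈ H_{r,s,t} ↔ wx ∈ H_{r,s,t})` iff `H_{wr,ws,wt} = H_{r,s,t}`
("`H_{r,s,t} = wH_{r,s,t} = H_{⟨w⁻¹r⟩,⟨w⁻¹s⟩,⟨w⁻¹t⟩}`"). [cite: KoblitzRohrlich1978, §1 (p. 1185)] -/
theorem forall_mem_iff_mul_mem_iff_fermatCMType_mul_eq {r s t w : ZMod N} (hw : IsUnit w) :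
    (∀ x, x ∈ fermatCMType N r s t ↔ w * x ∈ fermatCMType N r s t) ↔
      fermatCMType N (w * r) (w * s) (w * t) = fermatCMType N r s t := by
  rw [eq_comm, Finset.ext_iff]
  refine forall_congr' fun x => ?_
  rw [mem_fermatCMType_mul_iff_of_isUnit hw]

/-- **A stabilising unit gives a coincidence**: if `t` is a unit with `ct ∈ H_{1,a,−1−a} ⟺ c ∈ H_{1,a,−1−a}` for all units `c`
(`t ∈ W_{1,a,−1−a}`), then `H_{t,ta,t(−1−a)} = H_{1,a,−1−a}` ("if `w` is in `W_{r,s,t}`, then `H_{r,s,t} = wH_{r,s,t} = H_{⟨w⁻¹r⟩,⟨w⁻¹s⟩,⟨w⁻¹t⟩}`",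
with `w = t⁻¹`). [cite: KoblitzRohrlich1978, §1 (p. 1185)] -/
theorem fermatCMType_mul_eq_of_forall_mem_unitResidues {a t : ZMod N} (ht : IsUnit t)
    (hstab : ∀ c ∈ unitResidues N, (c * t ∈ fermatCMType N 1 a (-1 - a) ↔ c ∈ fermatCMType N 1 a (-1 - a))) :
    fermatCMType N t (t * a) (t * (-1 - a)) = fermatCMType N 1 a (-1 - a) := by
  ext x
  have key := mem_fermatCMType_mul_iff_of_isUnit ht 1 a (-1 - a) x
  rw [mul_one] at key
  rw [key]
  by_cases hx : IsUnit x
  · rw [mul_comm]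
    exact hstab x ((mem_unitResidues_iff_isUnit x).2 hx)
  · constructor
    · exact fun h => absurd (isUnit_of_mul_isUnit_right (isUnit_of_mem_fermatCMType h)) hx
    · exact fun h => absurd (isUnit_of_mem_fermatCMType h) hx

/-- **K–R's deduction of THEOREM 2 (relatively prime case), with a Remark-2 enumeration in place of the strong (∗)**: suppose that at
level `N` every NON-obvious coincidence `H_{r′,s′,−r′−s′} = H_{1,s,−1−s}`, `{r′,s′,−r′−s′} ≠ {1,s,−1−s}`, among unit triples forces
`s ∈ {ρ₁, ρ₂}` where `1 + ρᵢ + ρᵢ² = 0`, `ρᵢ ≠ 1`.  Then for units `a`, `1 + a`: `W_{1,a,−1−a} = {1}` iff NOT (`1 + a + a² = 0` and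
`a ≠ 1`) — a stabilising `w ≠ 1` gives either an obvious coincidence `{w, wa, w(−1−a)} = {1, a, −1−a}` ("one deduces that for `w ≠ 1`,
either `1 + w + w² = 0` … or `w² = 1`", the latter empty for units: tree `eq_one_or_of_multiset_eq_of_isUnit`) or a non-obvious one.
[cite: KoblitzRohrlich1978, §1 (pp. 1184–1185, proof of Theorem 2) and §2 Remark 2 (p. 1193)] -/
theorem hasTrivialStabilizer_fermat_one_iff_of_remarkTwo {ρ₁ ρ₂ : ZMod N} (hρ₁ : 1 + ρ₁ + ρ₁ ^ 2 = 0 ∧ ρ₁ ≠ 1)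
    (hρ₂ : 1 + ρ₂ + ρ₂ ^ 2 = 0 ∧ ρ₂ ≠ 1)
    (R : ∀ s r' s' : ZMod N, s.val.Coprime N → (-1 - s : ZMod N).val.Coprime N →
      r'.val.Coprime N → s'.val.Coprime N → (-r' - s' : ZMod N).val.Coprime N →
      fermatCMType N r' s' (-r' - s') = fermatCMType N 1 s (-1 - s) →
      ({r', s', -r' - s'} : Multiset (ZMod N)) ≠ {1, s, -1 - s} → s = ρ₁ ∨ s = ρ₂)
    {a : ZMod N} (ha : IsUnit a) (ha1 : IsUnit (1 + a)) :
    HasTrivialStabilizer N (fermatCMType N 1 a (-1 - a)) ↔ ¬(1 + a + a ^ 2 = 0 ∧ a ≠ 1) := by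
  constructor
  · rintro hW ⟨h0, h1⟩
    exact not_hasTrivialStabilizer_firstFamily h0 h1 hW
  · intro H t ht hstab
    have htu : IsUnit t := (mem_unitResidues_iff_isUnit t).1 ht
    have heq := fermatCMType_mul_eq_of_forall_mem_unitResidues htu hstab
    by_cases hm : ({t, t * a, t * (-1 - a)} : Multiset (ZMod N)) = {1, a, -1 - a}
    · rcases eq_one_or_of_multiset_eq_of_isUnit ha ha1 htu hm with h1 | ⟨h0, hne, -⟩
      · exact h1
      · exact absurd ⟨h0, hne⟩ H
    · exfalso
      have hb : IsUnit (-1 - a : ZMod N) := by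
        rw [show (-1 - a : ZMod N) = -(1 + a) by ring]
        exact ha1.neg
      have e : t * (-1 - a) = -t - t * a := by ring
      rw [e] at heq hm
      rcases R a t (t * a) ((isUnit_iff_val_coprime₁₀ _).1 ha) ((isUnit_iff_val_coprime₁₀ _).1 hb)
          ((isUnit_iff_val_coprime₁₀ _).1 htu) ((isUnit_iff_val_coprime₁₀ _).1 (htu.mul ha))
          (by rw [← e]; exact (isUnit_iff_val_coprime₁₀ _).1 (htu.mul hb)) heq hm with rfl | rfl
      · exact H hρ₁
      · exact H hρ₂

variable {L : Type} [Field L] [NumberField L] [IsCyclotomicExtension {N} ℚ L]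

/-- **THEOREM 2 on CM types from a Remark-2 enumeration** (any level `N`): under the hypothesis of
`hasTrivialStabilizer_fermat_one_iff_of_remarkTwo`, `Φ_{(1,a,−1−a)}` (`a`, `1 + a` units) is PRIMITIVE iff NOT (`1 + a + a² = 0` and
`a ≠ 1`) ("`L_{r,s}` is simple if and only if `W_{r,s} = {1}`": tree `isPrimitive_iff_hasTrivialStabilizer`).
[cite: KoblitzRohrlich1978, Theorem 2 (pp. 1185–1186) and §1 (p. 1184)] [cite: Shimura1998, §8.2 Prop. 26] -/
theorem isPrimitive_fermat_one_iff_of_remarkTwo {ρ₁ ρ₂ : ZMod N} (hρ₁ : 1 + ρ₁ + ρ₁ ^ 2 = 0 ∧ ρ₁ ≠ 1)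
    (hρ₂ : 1 + ρ₂ + ρ₂ ^ 2 = 0 ∧ ρ₂ ≠ 1)
    (R : ∀ s r' s' : ZMod N, s.val.Coprime N → (-1 - s : ZMod N).val.Coprime N →
      r'.val.Coprime N → s'.val.Coprime N → (-r' - s' : ZMod N).val.Coprime N →
      fermatCMType N r' s' (-r' - s') = fermatCMType N 1 s (-1 - s) →
      ({r', s', -r' - s'} : Multiset (ZMod N)) ≠ {1, s, -1 - s} → s = ρ₁ ∨ s = ρ₂)
    {a : ZMod N} (ha : IsUnit a) (ha1 : IsUnit (1 + a))
    {hS : ∀ c : ZMod N, c.val.Coprime N → (c ∈ fermatCMType N 1 a (-1 - a) ↔ -c ∉ fermatCMType N 1 a (-1 - a))}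
    (φ₀ : L →+* ℂ) :
    IsPrimitive (ℂ ≃+* ℂ) (cmTypeOfResidues (L := L) (fermatCMType N 1 a (-1 - a)) hS).1 φ₀ ↔
      ¬(1 + a + a ^ 2 = 0 ∧ a ≠ 1) := by
  rw [CyclotomicCMTypeResidueSets.isPrimitive_iff_hasTrivialStabilizer N,
    CyclotomicCMTypeResidueSets.residueSet_cmTypeOfResidues N (isCMResidueSet_fermatCMType hS)]
  exact hasTrivialStabilizer_fermat_one_iff_of_remarkTwo hρ₁ hρ₂ R ha ha1

variable {A : AbelianVariety ℂ} {ι : 𝓞 L →+* End A} {θ : L →+* Module.End ℂ (complexBetti A.X 1)}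

/-- **THEOREM 2 on abelian varieties from a Remark-2 enumeration** (any level `N`): an abelian variety of type
`(ℚ(ζ_N); Φ_{(1,a,−1−a)})` is SIMPLE iff NOT (`1 + a + a² = 0` and `a ≠ 1`) (simple ⟺ primitive, tree `isSimple_iff_isPrimitive`).
[cite: KoblitzRohrlich1978, Theorem 2 (pp. 1185–1186)] [cite: Shimura1998, §8.2 Prop. 26] -/
theorem isSimple_of_fermat_one_iff_of_remarkTwo {ρ₁ ρ₂ : ZMod N} (hρ₁ : 1 + ρ₁ + ρ₁ ^ 2 = 0 ∧ ρ₁ ≠ 1)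
    (hρ₂ : 1 + ρ₂ + ρ₂ ^ 2 = 0 ∧ ρ₂ ≠ 1)
    (R : ∀ s r' s' : ZMod N, s.val.Coprime N → (-1 - s : ZMod N).val.Coprime N →
      r'.val.Coprime N → s'.val.Coprime N → (-r' - s' : ZMod N).val.Coprime N →
      fermatCMType N r' s' (-r' - s') = fermatCMType N 1 s (-1 - s) →
      ({r', s', -r' - s'} : Multiset (ZMod N)) ≠ {1, s, -1 - s} → s = ρ₁ ∨ s = ρ₂)
    {a : ZMod N} (ha : IsUnit a) (ha1 : IsUnit (1 + a))
    {hS : ∀ c : ZMod N, c.val.Coprime N → (c ∈ fermatCMType N 1 a (-1 - a) ↔ -c ∉ fermatCMType N 1 a (-1 - a))}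
    (hA : IsCMTypeRealisation (cmTypeOfResidues (L := L) (fermatCMType N 1 a (-1 - a)) hS) A ι θ) :
    A.IsSimple ↔ ¬(1 + a + a ^ 2 = 0 ∧ a ≠ 1) := by
  obtain ⟨φ₀⟩ : Nonempty (L →+* ℂ) := inferInstance
  rw [isSimple_iff_isPrimitive hA φ₀, isPrimitive_fermat_one_iff_of_remarkTwo hρ₁ hρ₂ R ha ha1 φ₀]

end AnyLevel

/-! ## §2 `N = 21`: the stabilisers, and Theorem 2 -/

section TwentyOne

/-- At `N = 21`, `1 + a + a² = 0 ∧ a ≠ 1` iff `a ∈ {4, 16}` (`= {ρ, ρ²}`; kernel computation). [cite: KoblitzRohrlich1978, §2 Remark 2 (p. 1193)] -/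
theorem one_add_add_sq_eq_zero_iff_twentyOne : ∀ a : ZMod 21, (1 + a + a ^ 2 = 0 ∧ a ≠ 1) ↔ (a = 4 ∨ a = 16) := by
  decide

/-- **The stabilisers at `N = 21`, Finset form** (kernel computation over all units `a`, `w` with `1 + a` a unit): `H_{w,wa,w(−1−a)} =
H_{1,a,−1−a}` iff `w = 1`, or `1 + a + a² = 0` and `w ∈ {1, 2, 4, 8, 11, 16} = H_{1,4,16}` — `W = {1}` off the first family, `|W| = 6` on it.
[cite: KoblitzRohrlich1978, §1 (p. 1184) and §2 Remark 2 (p. 1193)] -/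
theorem fermatCMType_mul_eq_iff_twentyOne :
    ∀ a w : ZMod 21, a.val.Coprime 21 → (1 + a : ZMod 21).val.Coprime 21 → w.val.Coprime 21 →
      (fermatCMType 21 w (w * a) (w * (-1 - a)) = fermatCMType 21 1 a (-1 - a) ↔
        (w = 1 ∨ (1 + a + a ^ 2 = 0 ∧ w ∈ ({1, 2, 4, 8, 11, 16} : Finset (ZMod 21))))) := by
  decide

/-- **`W_{1,a,−1−a}` at `N = 21`**: for units `a`, `1 + a`, `w` modulo `21`, `wH_{1,a,−1−a} = H_{1,a,−1−a}` iff `w = 1`, or `1 + a + a² = 0`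
and `w ∈ H_{1,4,16}` (the sibling's `W_{1,4,16} = H_{1,4,16}` of order `6`, now for every `a`).
[cite: KoblitzRohrlich1978, §1 (p. 1184) and §2 Remark 2 (p. 1193)] -/
theorem forall_mem_fermatCMType_one_iff_mul_mem_iff_twentyOne {a w : ZMod 21} (ha : IsUnit a) (ha1 : IsUnit (1 + a))
    (hw : IsUnit w) :
    (∀ x, x ∈ fermatCMType 21 1 a (-1 - a) ↔ w * x ∈ fermatCMType 21 1 a (-1 - a)) ↔
      w = 1 ∨ (1 + a + a ^ 2 = 0 ∧ w ∈ fermatCMType 21 1 4 16) := by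
  rw [forall_mem_iff_mul_mem_iff_fermatCMType_mul_eq hw, mul_one, fermatCMType_twentyOne_one_four_sixteen]
  exact fermatCMType_mul_eq_iff_twentyOne a w ((isUnit_iff_val_coprime₁₀ _).1 ha) ((isUnit_iff_val_coprime₁₀ _).1 ha1)
    ((isUnit_iff_val_coprime₁₀ _).1 hw)

/-- **THEOREM 2's stabiliser dichotomy HOLDS at `N = 21`**: for units `a`, `1 + a` modulo `21`, `W_{1,a,−1−a} = {1}` iff NOT
(`1 + a + a² = 0` and `a ≠ 1`). [cite: KoblitzRohrlich1978, Theorem 2 (pp. 1185–1186) and §2 Remark 2 (p. 1193)] -/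
theorem hasTrivialStabilizer_fermat_one_iff_twentyOne {a : ZMod 21} (ha : IsUnit a) (ha1 : IsUnit (1 + a)) :
    HasTrivialStabilizer 21 (fermatCMType 21 1 a (-1 - a)) ↔ ¬(1 + a + a ^ 2 = 0 ∧ a ≠ 1) :=
  hasTrivialStabilizer_fermat_one_iff_of_remarkTwo (ρ₁ := 4) (ρ₂ := 16) (by decide) (by decide)
    eq_four_or_eq_sixteen_of_fermatCMType_eq_of_ne_twentyOne ha ha1

open CategoryTheory
open Literature.AlgebraicGeometry.Motives (AbelianVariety)

variable {L : Type} [Field L] [NumberField L] [IsCyclotomicExtension {21} ℚ L]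

/-- **THEOREM 2 on CM types HOLDS at `N = 21`**: `Φ_{(1,a,−1−a)}` of `ℚ(ζ₂₁)` (`a`, `1 + a` units) is primitive iff NOT (`1 + a + a² = 0`
and `a ≠ 1`), i.e. iff `a ∉ {4, 16}`. [cite: KoblitzRohrlich1978, Theorem 2 (pp. 1185–1186) and §2 Remark 2 (p. 1193)] [cite: Shimura1998, §8.2 Prop. 26] -/
theorem isPrimitive_fermat_one_iff_twentyOne {a : ZMod 21} (ha : IsUnit a) (ha1 : IsUnit (1 + a))
    {hS : ∀ c : ZMod 21, c.val.Coprime 21 → (c ∈ fermatCMType 21 1 a (-1 - a) ↔ -c ∉ fermatCMType 21 1 a (-1 - a))}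
    (φ₀ : L →+* ℂ) :
    IsPrimitive (ℂ ≃+* ℂ) (cmTypeOfResidues (L := L) (fermatCMType 21 1 a (-1 - a)) hS).1 φ₀ ↔
      ¬(1 + a + a ^ 2 = 0 ∧ a ≠ 1) :=
  isPrimitive_fermat_one_iff_of_remarkTwo (ρ₁ := 4) (ρ₂ := 16) (by decide) (by decide)
    eq_four_or_eq_sixteen_of_fermatCMType_eq_of_ne_twentyOne ha ha1 φ₀

variable {A : AbelianVariety ℂ} {ι : 𝓞 L →+* End A} {θ : L →+* Module.End ℂ (complexBetti A.X 1)}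

/-- **THEOREM 2 on abelian varieties HOLDS at `N = 21`**: an abelian variety of type `(ℚ(ζ₂₁); Φ_{(1,a,−1−a)})` (`a`, `1 + a` units) is
SIMPLE iff NOT (`1 + a + a² = 0` and `a ≠ 1`). [cite: KoblitzRohrlich1978, Theorem 2 (pp. 1185–1186) and §2 Remark 2 (p. 1193)] [cite: Shimura1998, §8.2 Prop. 26] -/
theorem isSimple_of_fermat_one_iff_twentyOne {a : ZMod 21} (ha : IsUnit a) (ha1 : IsUnit (1 + a))
    {hS : ∀ c : ZMod 21, c.val.Coprime 21 → (c ∈ fermatCMType 21 1 a (-1 - a) ↔ -c ∉ fermatCMType 21 1 a (-1 - a))}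
    (hA : IsCMTypeRealisation (cmTypeOfResidues (L := L) (fermatCMType 21 1 a (-1 - a)) hS) A ι θ) :
    A.IsSimple ↔ ¬(1 + a + a ^ 2 = 0 ∧ a ≠ 1) :=
  isSimple_of_fermat_one_iff_of_remarkTwo (ρ₁ := 4) (ρ₂ := 16) (by decide) (by decide)
    eq_four_or_eq_sixteen_of_fermatCMType_eq_of_ne_twentyOne ha ha1 hA

/-- **Non-vacuity at `N = 21`**: for units `a`, `1 + a` with NOT (`1 + a + a² = 0 ∧ a ≠ 1`) there is a SIMPLE `6`-dimensional abelian
variety of type `Φ_{(1,a,−1−a)}` of `ℚ(ζ₂₁)`. [cite: Shimura1998, §6.2 Thm. 3] [cite: KoblitzRohrlich1978, Theorem 2 and §2 Remark 2] -/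
theorem exists_isSimple_of_fermat_one_twentyOne {a : ZMod 21} (ha : IsUnit a) (ha1 : IsUnit (1 + a))
    (H : ¬(1 + a + a ^ 2 = 0 ∧ a ≠ 1))
    (hS : ∀ c : ZMod 21, c.val.Coprime 21 → (c ∈ fermatCMType 21 1 a (-1 - a) ↔ -c ∉ fermatCMType 21 1 a (-1 - a))) :
    ∃ (B : AbelianVariety ℂ) (ι' : 𝓞 L →+* End B) (θ' : L →+* Module.End ℂ (complexBetti B.X 1)),
      IsCMTypeRealisation (cmTypeOfResidues (L := L) (fermatCMType 21 1 a (-1 - a)) hS) B ι' θ' ∧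
        B.IsSimple ∧ B.dim = 6 := by
  haveI : IsCMField L := IsCyclotomicExtension.Rat.isCMField L (S := {21}) ⟨21, rfl, by norm_num⟩
  obtain ⟨B, ι', θ', hB⟩ := exists_isCMTypeRealisation (cmTypeOfResidues (L := L) (fermatCMType 21 1 a (-1 - a)) hS)
  exact ⟨B, ι', θ', hB, (isSimple_of_fermat_one_iff_twentyOne ha ha1 hB).2 H,
    (dim_eq_of_realisation (N := 21) hB).trans (by decide)⟩

end TwentyOne

/-! ## §3 `N = 39`: the stabilisers, and Theorem 2 -/

section ThirtyNine

/-- At `N = 39`, `1 + a + a² = 0 ∧ a ≠ 1` iff `a ∈ {16, 22}` (`= {ρ, ρ²}`; kernel computation). [cite: KoblitzRohrlich1978, §2 Remark 2 (p. 1193)] -/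
theorem one_add_add_sq_eq_zero_iff_thirtyNine : ∀ a : ZMod 39, (1 + a + a ^ 2 = 0 ∧ a ≠ 1) ↔ (a = 16 ∨ a = 22) := by
  decide

set_option maxRecDepth 100000 in
/-- **The stabilisers at `N = 39`, Finset form** (kernel computation): for units `a`, `1 + a`, `w` modulo `39`, `H_{w,wa,w(−1−a)} =
H_{1,a,−1−a}` iff `w = 1`, or `1 + a + a² = 0` and `w ∈ H_{1,16,22}` (`|W| = 12`).
[cite: KoblitzRohrlich1978, §1 (p. 1184) and §2 Remark 2 (p. 1193)] -/
theorem fermatCMType_mul_eq_iff_thirtyNine :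
    ∀ a w : ZMod 39, a.val.Coprime 39 → (1 + a : ZMod 39).val.Coprime 39 → w.val.Coprime 39 →
      (fermatCMType 39 w (w * a) (w * (-1 - a)) = fermatCMType 39 1 a (-1 - a) ↔
        (w = 1 ∨ (1 + a + a ^ 2 = 0 ∧ w ∈ ({1, 2, 4, 5, 8, 10, 11, 16, 20, 22, 25, 32} : Finset (ZMod 39))))) := by
  decide

/-- **`W_{1,a,−1−a}` at `N = 39`**: for units `a`, `1 + a`, `w` modulo `39`, `wH_{1,a,−1−a} = H_{1,a,−1−a}` iff `w = 1`, or
`1 + a + a² = 0` and `w ∈ H_{1,16,22}` (order `12`). [cite: KoblitzRohrlich1978, §1 (p. 1184) and §2 Remark 2 (p. 1193)] -/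
theorem forall_mem_fermatCMType_one_iff_mul_mem_iff_thirtyNine {a w : ZMod 39} (ha : IsUnit a) (ha1 : IsUnit (1 + a))
    (hw : IsUnit w) :
    (∀ x, x ∈ fermatCMType 39 1 a (-1 - a) ↔ w * x ∈ fermatCMType 39 1 a (-1 - a)) ↔
      w = 1 ∨ (1 + a + a ^ 2 = 0 ∧ w ∈ fermatCMType 39 1 16 22) := by
  rw [forall_mem_iff_mul_mem_iff_fermatCMType_mul_eq hw, mul_one, fermatCMType_thirtyNine_one_sixteen_twentyTwo]
  exact fermatCMType_mul_eq_iff_thirtyNine a w ((isUnit_iff_val_coprime₁₀ _).1 ha) ((isUnit_iff_val_coprime₁₀ _).1 ha1)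
    ((isUnit_iff_val_coprime₁₀ _).1 hw)

/-- **THEOREM 2's stabiliser dichotomy HOLDS at `N = 39`**: `W_{1,a,−1−a} = {1}` iff NOT (`1 + a + a² = 0` and `a ≠ 1`), for units
`a`, `1 + a` modulo `39`. [cite: KoblitzRohrlich1978, Theorem 2 (pp. 1185–1186) and §2 Remark 2 (p. 1193)] -/
theorem hasTrivialStabilizer_fermat_one_iff_thirtyNine {a : ZMod 39} (ha : IsUnit a) (ha1 : IsUnit (1 + a)) :
    HasTrivialStabilizer 39 (fermatCMType 39 1 a (-1 - a)) ↔ ¬(1 + a + a ^ 2 = 0 ∧ a ≠ 1) :=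
  hasTrivialStabilizer_fermat_one_iff_of_remarkTwo (ρ₁ := 16) (ρ₂ := 22) (by decide) (by decide)
    eq_sixteen_or_eq_twentyTwo_of_fermatCMType_eq_of_ne_thirtyNine ha ha1

open CategoryTheory
open Literature.AlgebraicGeometry.Motives (AbelianVariety)

variable {L : Type} [Field L] [NumberField L] [IsCyclotomicExtension {39} ℚ L]

/-- **THEOREM 2 on CM types HOLDS at `N = 39`**: `Φ_{(1,a,−1−a)}` of `ℚ(ζ₃₉)` (`a`, `1 + a` units) is primitive iff NOT (`1 + a + a² = 0`
and `a ≠ 1`), i.e. iff `a ∉ {16, 22}`. [cite: KoblitzRohrlich1978, Theorem 2 (pp. 1185–1186) and §2 Remark 2 (p. 1193)] [cite: Shimura1998, §8.2 Prop. 26] -/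
theorem isPrimitive_fermat_one_iff_thirtyNine {a : ZMod 39} (ha : IsUnit a) (ha1 : IsUnit (1 + a))
    {hS : ∀ c : ZMod 39, c.val.Coprime 39 → (c ∈ fermatCMType 39 1 a (-1 - a) ↔ -c ∉ fermatCMType 39 1 a (-1 - a))}
    (φ₀ : L →+* ℂ) :
    IsPrimitive (ℂ ≃+* ℂ) (cmTypeOfResidues (L := L) (fermatCMType 39 1 a (-1 - a)) hS).1 φ₀ ↔
      ¬(1 + a + a ^ 2 = 0 ∧ a ≠ 1) :=
  isPrimitive_fermat_one_iff_of_remarkTwo (ρ₁ := 16) (ρ₂ := 22) (by decide) (by decide)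
    eq_sixteen_or_eq_twentyTwo_of_fermatCMType_eq_of_ne_thirtyNine ha ha1 φ₀

variable {A : AbelianVariety ℂ} {ι : 𝓞 L →+* End A} {θ : L →+* Module.End ℂ (complexBetti A.X 1)}

/-- **THEOREM 2 on abelian varieties HOLDS at `N = 39`**: an abelian variety of type `(ℚ(ζ₃₉); Φ_{(1,a,−1−a)})` (`a`, `1 + a` units) is
SIMPLE iff NOT (`1 + a + a² = 0` and `a ≠ 1`). [cite: KoblitzRohrlich1978, Theorem 2 (pp. 1185–1186) and §2 Remark 2 (p. 1193)] [cite: Shimura1998, §8.2 Prop. 26] -/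
theorem isSimple_of_fermat_one_iff_thirtyNine {a : ZMod 39} (ha : IsUnit a) (ha1 : IsUnit (1 + a))
    {hS : ∀ c : ZMod 39, c.val.Coprime 39 → (c ∈ fermatCMType 39 1 a (-1 - a) ↔ -c ∉ fermatCMType 39 1 a (-1 - a))}
    (hA : IsCMTypeRealisation (cmTypeOfResidues (L := L) (fermatCMType 39 1 a (-1 - a)) hS) A ι θ) :
    A.IsSimple ↔ ¬(1 + a + a ^ 2 = 0 ∧ a ≠ 1) :=
  isSimple_of_fermat_one_iff_of_remarkTwo (ρ₁ := 16) (ρ₂ := 22) (by decide) (by decide)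
    eq_sixteen_or_eq_twentyTwo_of_fermatCMType_eq_of_ne_thirtyNine ha ha1 hA

/-- **Non-vacuity at `N = 39`**: for units `a`, `1 + a` with NOT (`1 + a + a² = 0 ∧ a ≠ 1`) there is a SIMPLE `12`-dimensional abelian
variety of type `Φ_{(1,a,−1−a)}` of `ℚ(ζ₃₉)`. [cite: Shimura1998, §6.2 Thm. 3] [cite: KoblitzRohrlich1978, Theorem 2 and §2 Remark 2] -/
theorem exists_isSimple_of_fermat_one_thirtyNine {a : ZMod 39} (ha : IsUnit a) (ha1 : IsUnit (1 + a))
    (H : ¬(1 + a + a ^ 2 = 0 ∧ a ≠ 1))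
    (hS : ∀ c : ZMod 39, c.val.Coprime 39 → (c ∈ fermatCMType 39 1 a (-1 - a) ↔ -c ∉ fermatCMType 39 1 a (-1 - a))) :
    ∃ (B : AbelianVariety ℂ) (ι' : 𝓞 L →+* End B) (θ' : L →+* Module.End ℂ (complexBetti B.X 1)),
      IsCMTypeRealisation (cmTypeOfResidues (L := L) (fermatCMType 39 1 a (-1 - a)) hS) B ι' θ' ∧
        B.IsSimple ∧ B.dim = 12 := by
  haveI : IsCMField L := IsCyclotomicExtension.Rat.isCMField L (S := {39}) ⟨39, rfl, by norm_num⟩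
  obtain ⟨B, ι', θ', hB⟩ := exists_isCMTypeRealisation (cmTypeOfResidues (L := L) (fermatCMType 39 1 a (-1 - a)) hS)
  exact ⟨B, ι', θ', hB, (isSimple_of_fermat_one_iff_thirtyNine ha ha1 hB).2 H,
    (dim_eq_of_realisation (N := 39) hB).trans (by decide)⟩

end ThirtyNine

/-! ## §4 THEOREM 2 at every odd two-prime level `N = pᵃqᵇ`, no exception -/

section OddTwoPrimeLevel

open CategoryTheory
open Literature.AlgebraicGeometry.Motives (AbelianVariety)

variable {p q a b N : ℕ} [hp : Fact p.Prime] [hq : Fact q.Prime] [NeZero N]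
variable {L : Type} [Field L] [NumberField L] [IsCyclotomicExtension {N} ℚ L]
  {A : AbelianVariety ℂ} {ι : 𝓞 L →+* End A} {θ : L →+* Module.End ℂ (complexBetti A.X 1)}

/-- **THEOREM 2 on CM types at EVERY odd two-prime level** `N = pᵃqᵇ` (`p ≠ q` odd primes, `a, b ≥ 1`): `Φ_{(1,a₀,−1−a₀)}` of `ℚ(ζ_N)`
(`a₀`, `1 + a₀` units) is primitive iff NOT (`1 + a₀ + a₀² = 0` and `a₀ ≠ 1`) — the sibling's `isPrimitive_fermat_one_iff_oddTwoPrimes`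
without `N ≠ 21`, `N ≠ 39`. [cite: KoblitzRohrlich1978, Theorem 2 (pp. 1185–1186) and §2 Remark 2 (p. 1193)] [cite: Shimura1998, §8.2 Prop. 26] -/
theorem isPrimitive_fermat_one_iff_oddTwoPrimeLevel (hp2 : p ≠ 2) (hq2 : q ≠ 2) (hpq : p ≠ q) (ha : a ≠ 0) (hb : b ≠ 0)
    (hN : N = p ^ a * q ^ b) {a₀ : ZMod N} (ha₀ : IsUnit a₀) (ha₁ : IsUnit (1 + a₀))
    {hS : ∀ c : ZMod N, c.val.Coprime N → (c ∈ fermatCMType N 1 a₀ (-1 - a₀) ↔ -c ∉ fermatCMType N 1 a₀ (-1 - a₀))}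
    (φ₀ : L →+* ℂ) :
    IsPrimitive (ℂ ≃+* ℂ) (cmTypeOfResidues (L := L) (fermatCMType N 1 a₀ (-1 - a₀)) hS).1 φ₀ ↔
      ¬(1 + a₀ + a₀ ^ 2 = 0 ∧ a₀ ≠ 1) := by
  by_cases h21 : N = 21
  · subst h21
    exact isPrimitive_fermat_one_iff_twentyOne ha₀ ha₁ φ₀
  by_cases h39 : N = 39
  · subst h39
    exact isPrimitive_fermat_one_iff_thirtyNine ha₀ ha₁ φ₀
  exact isPrimitive_fermat_one_iff_oddTwoPrimes hp2 hq2 hpq ha hb hN h21 h39 ha₀ ha₁ φ₀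

/-- **THEOREM 2 on abelian varieties at EVERY odd two-prime level** `N = pᵃqᵇ`: an abelian variety of type `(ℚ(ζ_N); Φ_{(1,a₀,−1−a₀)})`
(`a₀`, `1 + a₀` units) is SIMPLE iff NOT (`1 + a₀ + a₀² = 0` and `a₀ ≠ 1`).
[cite: KoblitzRohrlich1978, Theorem 2 (pp. 1185–1186) and §2 Remark 2 (p. 1193)] [cite: Shimura1998, §8.2 Prop. 26] -/
theorem isSimple_of_fermat_one_iff_oddTwoPrimeLevel (hp2 : p ≠ 2) (hq2 : q ≠ 2) (hpq : p ≠ q) (ha : a ≠ 0) (hb : b ≠ 0)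
    (hN : N = p ^ a * q ^ b) {a₀ : ZMod N} (ha₀ : IsUnit a₀) (ha₁ : IsUnit (1 + a₀))
    {hS : ∀ c : ZMod N, c.val.Coprime N → (c ∈ fermatCMType N 1 a₀ (-1 - a₀) ↔ -c ∉ fermatCMType N 1 a₀ (-1 - a₀))}
    (hA : IsCMTypeRealisation (cmTypeOfResidues (L := L) (fermatCMType N 1 a₀ (-1 - a₀)) hS) A ι θ) :
    A.IsSimple ↔ ¬(1 + a₀ + a₀ ^ 2 = 0 ∧ a₀ ≠ 1) := by
  obtain ⟨φ₀⟩ : Nonempty (L →+* ℂ) := inferInstance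
  rw [isSimple_iff_isPrimitive hA φ₀, isPrimitive_fermat_one_iff_oddTwoPrimeLevel hp2 hq2 hpq ha hb hN ha₀ ha₁ φ₀]

/-- **Non-vacuity at every odd two-prime level**: for units `a₀`, `1 + a₀` with NOT (`1 + a₀ + a₀² = 0 ∧ a₀ ≠ 1`) there is a SIMPLE abelian
variety of dimension `φ(N)/2` of type `Φ_{(1,a₀,−1−a₀)}` of `ℚ(ζ_N)`, `N = pᵃqᵇ`.
[cite: Shimura1998, §6.2 Thm. 3] [cite: KoblitzRohrlich1978, Theorem 2 and §2 Remark 2] -/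
theorem exists_isSimple_of_fermat_one_oddTwoPrimeLevel (hp2 : p ≠ 2) (hq2 : q ≠ 2) (hpq : p ≠ q) (ha : a ≠ 0) (hb : b ≠ 0)
    (hN : N = p ^ a * q ^ b) {a₀ : ZMod N} (ha₀ : IsUnit a₀) (ha₁ : IsUnit (1 + a₀)) (H : ¬(1 + a₀ + a₀ ^ 2 = 0 ∧ a₀ ≠ 1))
    (hS : ∀ c : ZMod N, c.val.Coprime N → (c ∈ fermatCMType N 1 a₀ (-1 - a₀) ↔ -c ∉ fermatCMType N 1 a₀ (-1 - a₀))) :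
    ∃ (B : AbelianVariety ℂ) (ι' : 𝓞 L →+* End B) (θ' : L →+* Module.End ℂ (complexBetti B.X 1)),
      IsCMTypeRealisation (cmTypeOfResidues (L := L) (fermatCMType N 1 a₀ (-1 - a₀)) hS) B ι' θ' ∧
        B.IsSimple ∧ B.dim = N.totient / 2 := by
  by_cases h21 : N = 21
  · subst h21
    obtain ⟨B, ι', θ', hB, h1, h2⟩ := exists_isSimple_of_fermat_one_twentyOne (L := L) ha₀ ha₁ H hS
    exact ⟨B, ι', θ', hB, h1, h2.trans (by decide)⟩
  by_cases h39 : N = 39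
  · subst h39
    obtain ⟨B, ι', θ', hB, h1, h2⟩ := exists_isSimple_of_fermat_one_thirtyNine (L := L) ha₀ ha₁ H hS
    exact ⟨B, ι', θ', hB, h1, h2.trans (by decide)⟩
  exact exists_isSimple_of_fermat_one_oddTwoPrimes hp2 hq2 hpq ha hb hN h21 h39 ha₀ ha₁ H hS

end OddTwoPrimeLevel

end CyclotomicFermatCMType

end Literature.AlgebraicGeometry.ComplexMultiplication
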